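import Summits.CriticalPhenomena.SAWScalingLimit.Theorems.SAWRenewalTightnessSubseqIdentificationBoundaryAreaLawReduction
import Summits.CriticalPhenomena.SAWScalingLimit.Theorems.SAWRenewalTightnessSubseqIdentificationSleHalfPlaneAreaLaw
import Summits.CriticalPhenomena.SAWScalingLimit.Theorems.SAWRenewalTightnessSubseqIdentificationSleAreaLawGlue
import Summits.CriticalPhenomena.SAWScalingLimit.Theorems.SAWRenewalTightnessSubseqIdentificationLatticeAreaLawOfLimitLaw
import Summits.CriticalPhenomena.SAWScalingLimit.Theorems.SAWRenewalTightnessSubseqIdentificationLatticeAreaLawNecessityGlue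
import Summits.CriticalPhenomena.SAWScalingLimit.Theorems.SAWRenewalTightnessSubseqIdentificationDockOfCrux
import Summits.CriticalPhenomena.SAWScalingLimit.Theorems.EventualTight.Negative.TightnessNecessary

/-!
# Line `boundary-area-law` for crux `SubseqIdentification` (stmt-CriticalPhenomena-0783): the NECESSITY
# theorem — the line's reduction is EXACT modulo tightness

The landed reduction theorem of the line (`SubseqIdentification_of_dock_of_latticeAreaLaw`, p99729)
reads `S1 ∧ S4 ∧ EventualTight → SubseqIdentification`, where S1 = `stub_identificationUpToKappa`
(the dock: identification of subsequential limits as SLE_κ, one `κ` per mesh sequence) and S4 =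
`stub_latticeAreaLaw` (the two-sided boundary area law of the critical `δℤ²` SAW at a flat lattice
wall, pointwise in `r`, eventual in `δ`). This file proves the CONVERSE directions:

* `sleAreaLawAtWindow` — the chordal SLE_{8/3} law of a Dobrushin domain with a flat window at
  `x₀ ∉ {a, b}` satisfies the two-sided `r²` law at `x₀` (lower bound for the open event
  `{dist(x₀, trace) < r}`, upper bound for the closed event `{dist ≤ r}`): Alberts–Kozdron upper /
  Beffara lower boundary estimates for the SLE_{8/3} trace (`stub_sleHalfPlaneAreaLaw`, exponent
  `8/κ − 1 = 2`), the flat-window transport `stub_windowTransport` and the glue `stub_sleAreaLawGlue`;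
  the Rohde–Schramm input `HasSLETrace (8/3)` is read off the law (`IsSLELaw.hasSLETrace`). This is
  the consistency half of the κ-pin S6 (`stub_kappaPin`: area law ⇒ `κ = 8/3`; here `κ = 8/3` ⇒ area law).
* `latticeAreaLaw_of_sawScalingLimit` — **`SAW.SAWScalingLimit → S4`**: under the summit conjunct the
  pushed SAW laws converge along the whole mesh filter to the SLE_{8/3} law, which has the `r²` law,
  and the portmanteau theorem along `𝓝[>] 0` (`stub_latticeAreaLawOfLimitLaw`) gives the lattice
  statement (glue `stub_latticeAreaLawNecessityGlue`). So S4 is implied by the Lawler–Schramm–Werner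
  conjecture as typed: a refutation of S4 refutes the conjunct.
* `latticeAreaLaw_of_subseqIdentification` — `EventualTight → SubseqIdentification → S4`, through the
  route's deciding theorem `closes : EventualTight → SubseqIdentification → SAWScalingLimit`.
* `subseqIdentification_iff_dock_and_latticeAreaLaw` — **modulo `EventualTight` (the route's rank-0
  target T′, stmt-CriticalPhenomena-1372) the crux IS the pair {S1, S4}**:
  `EventualTight → (SubseqIdentification ↔ S1 ∧ S4)` (`stub_dockOfCrux` gives crux ⇒ S1 with
  `κ := 8/3`). Each residual stub of the line is therefore NECESSARY, and the two together are
  SUFFICIENT: promoting S1 / filing S4 as items loses nothing and adds nothing.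

* `sawScalingLimit_iff_eventualTight_and_dock_and_latticeAreaLaw` — at the level of the summit conjunct:
  **`SAW.SAWScalingLimit ↔ EventualTight ∧ S1 ∧ S4`** (⇒: tightness is necessary —
  `EventualTight.Negative.exists_isTightMeasureSet_image_of_convergesInLawToSLE`, the landed mirror of
  Disproof cycle 2 §6; the dock and the area law are necessary — this file; ⇐: the reduction and the
  route's `closes`). The Lawler–Schramm–Werner conjecture on `δℤ²` as typed is EXACTLY: tightness of the
  critical SAW laws + identification of subsequential limits up to κ + the boundary area law.

No named fact is used; axioms `propext`, `Classical.choice`, `Quot.sound`.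
-/

open MeasureTheory Filter Topology Set
open scoped NNReal ENNReal BoundedContinuousFunction

namespace Summit.CriticalPhenomena.SAWScalingLimit.Theorems.SubseqIdentification.BoundaryAreaLaw

open Literature.Probability.RandomPlanarGeometry Literature.Probability.LatticeModels
open Literature.Probability.Process (preWienerMeasure)
open UpperHalfPlane (upperHalfPlaneSet)
open Summit.CriticalPhenomena.SAWScalingLimit.Theses.SAWParafermion (SubseqIdentification)
open Summit.CriticalPhenomena.SAWScalingLimit.Theses.SAWRenewalTightness (EventualTight closes)

/-- **The two-sided boundary area law of chordal SLE_{8/3} at a flat window.** If `μ` is the chordal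
SLE_{8/3} law of a Dobrushin domain `(D; a, b)` with `D ∩ B(x₀, ρ₀) = {Im z > Im x₀} ∩ B(x₀, ρ₀)`
and `x₀ ∉ {a, b}`, then there are `c, C, r₀ > 0` with `c r² ≤ μ[dist(x₀, trace) < r]` and
`μ[dist(x₀, trace) ≤ r] ≤ C r²` for all `0 < r ≤ r₀` (boundary exponent `8/κ − 1 = 2`).
[cite: AlbertsKozdron2007, Thm 1.1] -/
theorem sleAreaLawAtWindow :
    ∀ (D : DobrushinDomain) (μ : Measure (CurveClass ℂ)) (x₀ : ℂ) (ρ₀ : ℝ),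
      IsSLELaw ((8 : ℝ≥0) / 3) D μ → 0 < ρ₀ →
      D.carrier ∩ Metric.ball x₀ ρ₀ = {z : ℂ | x₀.im < z.im} ∩ Metric.ball x₀ ρ₀ →
      x₀ ≠ D.pt 0 → x₀ ≠ D.pt 1 →
      ∃ c C r₀ : ℝ, 0 < c ∧ 0 < C ∧ 0 < r₀ ∧ ∀ r : ℝ, 0 < r → r ≤ r₀ →
        ENNReal.ofReal (c * r ^ 2) ≤ μ {γ | Metric.infDist x₀ γ.range < r} ∧
          μ {γ | Metric.infDist x₀ γ.range ≤ r} ≤ ENNReal.ofReal (C * r ^ 2) :=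
  stub_sleAreaLawGlue stub_sleHalfPlaneAreaLaw stub_windowTransport

/-- **S4 IS NECESSARY: `SAW.SAWScalingLimit → stub_latticeAreaLaw`.** Under the summit conjunct (the
critical `δℤ²` SAW converges in law to chordal SLE_{8/3} in every Dobrushin domain with an endpoint
approximation), the lattice boundary area law S4 of line `boundary-area-law` holds: for every flat
window at `x₀ ∉ {a, b}` there are `C, ε₀ > 0` such that for every `0 < r ≤ ε₀`, eventually in
`δ → 0⁺`, `P_δ(≤ r) ε₀² ≤ C P_δ(≤ ε₀) r²` and `P_δ(≤ ε₀) r² ≤ C P_δ(≤ r) ε₀²`. [folklore] -/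
theorem latticeAreaLaw_of_sawScalingLimit :
    SAW.SAWScalingLimit →
    ∀ (D : DobrushinDomain) (a b : ℝ → Site 2), SAW.IsEndpointApprox D a b →
      ∀ (x₀ : ℂ) (ρ₀ : ℝ), 0 < ρ₀ →
        D.carrier ∩ Metric.ball x₀ ρ₀ = {z : ℂ | x₀.im < z.im} ∩ Metric.ball x₀ ρ₀ →
        x₀ ≠ D.pt 0 → x₀ ≠ D.pt 1 →
        ∃ C ε₀ : ℝ, 0 < C ∧ 0 < ε₀ ∧ ∀ r : ℝ, 0 < r → r ≤ ε₀ →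
          ∀ᶠ δ in 𝓝[>] (0 : ℝ),
            SAW.law D.carrier δ (a δ) (b δ) {γ | Metric.infDist x₀ γ.curve.range ≤ r} *
                ENNReal.ofReal (ε₀ ^ 2) ≤
              ENNReal.ofReal C *
                SAW.law D.carrier δ (a δ) (b δ) {γ | Metric.infDist x₀ γ.curve.range ≤ ε₀} *
                  ENNReal.ofReal (r ^ 2) ∧
            SAW.law D.carrier δ (a δ) (b δ) {γ | Metric.infDist x₀ γ.curve.range ≤ ε₀} *
                ENNReal.ofReal (r ^ 2) ≤
              ENNReal.ofReal C *
                SAW.law D.carrier δ (a δ) (b δ) {γ | Metric.infDist x₀ γ.curve.range ≤ r} *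
                  ENNReal.ofReal (ε₀ ^ 2) :=
  stub_latticeAreaLawNecessityGlue sleAreaLawAtWindow stub_latticeAreaLawOfLimitLaw

/-- **S4 from the crux and tightness**: `EventualTight → SubseqIdentification → stub_latticeAreaLaw`,
through the route's deciding theorem `closes` (tightness + identification ⇒ `SAWScalingLimit`) and
`latticeAreaLaw_of_sawScalingLimit`. [folklore] -/
theorem latticeAreaLaw_of_subseqIdentification (hT : EventualTight) (hI : SubseqIdentification) :
    ∀ (D : DobrushinDomain) (a b : ℝ → Site 2), SAW.IsEndpointApprox D a b →
      ∀ (x₀ : ℂ) (ρ₀ : ℝ), 0 < ρ₀ →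
        D.carrier ∩ Metric.ball x₀ ρ₀ = {z : ℂ | x₀.im < z.im} ∩ Metric.ball x₀ ρ₀ →
        x₀ ≠ D.pt 0 → x₀ ≠ D.pt 1 →
        ∃ C ε₀ : ℝ, 0 < C ∧ 0 < ε₀ ∧ ∀ r : ℝ, 0 < r → r ≤ ε₀ →
          ∀ᶠ δ in 𝓝[>] (0 : ℝ),
            SAW.law D.carrier δ (a δ) (b δ) {γ | Metric.infDist x₀ γ.curve.range ≤ r} *
                ENNReal.ofReal (ε₀ ^ 2) ≤
              ENNReal.ofReal C *
                SAW.law D.carrier δ (a δ) (b δ) {γ | Metric.infDist x₀ γ.curve.range ≤ ε₀} *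
                  ENNReal.ofReal (r ^ 2) ∧
            SAW.law D.carrier δ (a δ) (b δ) {γ | Metric.infDist x₀ γ.curve.range ≤ ε₀} *
                ENNReal.ofReal (r ^ 2) ≤
              ENNReal.ofReal C *
                SAW.law D.carrier δ (a δ) (b δ) {γ | Metric.infDist x₀ γ.curve.range ≤ r} *
                  ENNReal.ofReal (ε₀ ^ 2) :=
  latticeAreaLaw_of_sawScalingLimit (closes hT hI)

/-- **S1 IS NECESSARY at the summit level: `SAW.SAWScalingLimit → stub_identificationUpToKappa`**
(`Negative.subseqIdentification_of_sawScalingLimit`, then `stub_dockOfCrux` with `κ := 8/3`). [folklore] -/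
theorem dock_of_sawScalingLimit :
    SAW.SAWScalingLimit →
      ∀ (s : ℕ → ℝ), Tendsto s atTop (𝓝[>] (0 : ℝ)) →
        ∃ κ : ℝ≥0, 0 < κ ∧
          ∀ (D : DobrushinDomain) (a b : ℝ → Site 2), SAW.IsEndpointApprox D a b →
            ∀ (μ : Measure (CurveClass ℂ)), IsProbabilityMeasure μ →
              (∀ f : CurveClass ℂ →ᵇ ℝ,
                Tendsto (fun n => ∫ γ, f γ.curve ∂(SAW.law D.carrier (s n) (a (s n)) (b (s n))))
                  atTop (𝓝 (∫ x, f x ∂μ))) →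
              IsSLELaw κ D μ :=
  fun h => stub_dockOfCrux (Negative.subseqIdentification_of_sawScalingLimit h)

/-- **THE REDUCTION OF LINE `boundary-area-law` IS EXACT MODULO TIGHTNESS.** Under `EventualTight`
(the route's registered rank-0 target T′, stmt-CriticalPhenomena-1372) the crux
`SubseqIdentification` is EQUIVALENT to the conjunction of its two residual registered stubs:
the dock S1 `stub_identificationUpToKappa` (identification up to κ, one κ per mesh sequence) and the
lattice boundary area law S4 `stub_latticeAreaLaw`. (⇒: `stub_dockOfCrux` with `κ := 8/3` and
`latticeAreaLaw_of_subseqIdentification`; ⇐: the landed reduction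
`SubseqIdentification_of_dock_of_latticeAreaLaw`.) [folklore] -/
theorem subseqIdentification_iff_dock_and_latticeAreaLaw :
    EventualTight →
      (SubseqIdentification ↔
        ((∀ (s : ℕ → ℝ), Tendsto s atTop (𝓝[>] (0 : ℝ)) →
            ∃ κ : ℝ≥0, 0 < κ ∧
              ∀ (D : DobrushinDomain) (a b : ℝ → Site 2), SAW.IsEndpointApprox D a b →
                ∀ (μ : Measure (CurveClass ℂ)), IsProbabilityMeasure μ →
                  (∀ f : CurveClass ℂ →ᵇ ℝ,
                    Tendsto (fun n => ∫ γ, f γ.curve ∂(SAW.law D.carrier (s n) (a (s n)) (b (s n))))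
                      atTop (𝓝 (∫ x, f x ∂μ))) →
                  IsSLELaw κ D μ) ∧
          (∀ (D : DobrushinDomain) (a b : ℝ → Site 2), SAW.IsEndpointApprox D a b →
            ∀ (x₀ : ℂ) (ρ₀ : ℝ), 0 < ρ₀ →
              D.carrier ∩ Metric.ball x₀ ρ₀ = {z : ℂ | x₀.im < z.im} ∩ Metric.ball x₀ ρ₀ →
              x₀ ≠ D.pt 0 → x₀ ≠ D.pt 1 →
              ∃ C ε₀ : ℝ, 0 < C ∧ 0 < ε₀ ∧ ∀ r : ℝ, 0 < r → r ≤ ε₀ →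
                ∀ᶠ δ in 𝓝[>] (0 : ℝ),
                  SAW.law D.carrier δ (a δ) (b δ) {γ | Metric.infDist x₀ γ.curve.range ≤ r} *
                      ENNReal.ofReal (ε₀ ^ 2) ≤
                    ENNReal.ofReal C *
                      SAW.law D.carrier δ (a δ) (b δ)
                          {γ | Metric.infDist x₀ γ.curve.range ≤ ε₀} *
                        ENNReal.ofReal (r ^ 2) ∧
                  SAW.law D.carrier δ (a δ) (b δ) {γ | Metric.infDist x₀ γ.curve.range ≤ ε₀} *
                      ENNReal.ofReal (r ^ 2) ≤
                    ENNReal.ofReal C *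
                      SAW.law D.carrier δ (a δ) (b δ)
                          {γ | Metric.infDist x₀ γ.curve.range ≤ r} *
                        ENNReal.ofReal (ε₀ ^ 2)))) :=
  fun hT =>
    ⟨fun hI => ⟨stub_dockOfCrux hI, latticeAreaLaw_of_subseqIdentification hT hI⟩,
      fun h => SubseqIdentification_of_dock_of_latticeAreaLaw h.1 h.2 hT⟩

/-- **THE SUMMIT CONJUNCT DECOMPOSED: `SAWScalingLimit ↔ EventualTight ∧ S1 ∧ S4`.** Convergence of the
critical `δℤ²` SAW to chordal SLE_{8/3} in every Dobrushin domain (the Lawler–Schramm–Werner conjecture as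
typed, `SAW.SAWScalingLimit`) is EQUIVALENT to the conjunction of: eventual tightness of the pushed laws
(`EventualTight`, stmt-CriticalPhenomena-1372), identification of subsequential limits up to κ (S1) and the
lattice boundary area law at flat windows (S4). (⇒: `EventualTight.Negative.exists_isTightMeasureSet_image_of_convergesInLawToSLE`,
`dock_of_sawScalingLimit`, `latticeAreaLaw_of_sawScalingLimit`; ⇐: `SubseqIdentification_of_dock_of_latticeAreaLaw`
and the route's `closes`.) [folklore] -/
theorem sawScalingLimit_iff_eventualTight_and_dock_and_latticeAreaLaw :
    SAW.SAWScalingLimit ↔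
      (EventualTight ∧
        (∀ (s : ℕ → ℝ), Tendsto s atTop (𝓝[>] (0 : ℝ)) →
            ∃ κ : ℝ≥0, 0 < κ ∧
              ∀ (D : DobrushinDomain) (a b : ℝ → Site 2), SAW.IsEndpointApprox D a b →
                ∀ (μ : Measure (CurveClass ℂ)), IsProbabilityMeasure μ →
                  (∀ f : CurveClass ℂ →ᵇ ℝ,
                    Tendsto (fun n => ∫ γ, f γ.curve ∂(SAW.law D.carrier (s n) (a (s n)) (b (s n))))
                      atTop (𝓝 (∫ x, f x ∂μ))) →
                  IsSLELaw κ D μ) ∧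
        (∀ (D : DobrushinDomain) (a b : ℝ → Site 2), SAW.IsEndpointApprox D a b →
            ∀ (x₀ : ℂ) (ρ₀ : ℝ), 0 < ρ₀ →
              D.carrier ∩ Metric.ball x₀ ρ₀ = {z : ℂ | x₀.im < z.im} ∩ Metric.ball x₀ ρ₀ →
              x₀ ≠ D.pt 0 → x₀ ≠ D.pt 1 →
              ∃ C ε₀ : ℝ, 0 < C ∧ 0 < ε₀ ∧ ∀ r : ℝ, 0 < r → r ≤ ε₀ →
                ∀ᶠ δ in 𝓝[>] (0 : ℝ),
                  SAW.law D.carrier δ (a δ) (b δ) {γ | Metric.infDist x₀ γ.curve.range ≤ r} *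
                      ENNReal.ofReal (ε₀ ^ 2) ≤
                    ENNReal.ofReal C *
                      SAW.law D.carrier δ (a δ) (b δ)
                          {γ | Metric.infDist x₀ γ.curve.range ≤ ε₀} *
                        ENNReal.ofReal (r ^ 2) ∧
                  SAW.law D.carrier δ (a δ) (b δ) {γ | Metric.infDist x₀ γ.curve.range ≤ ε₀} *
                      ENNReal.ofReal (r ^ 2) ≤
                    ENNReal.ofReal C *
                      SAW.law D.carrier δ (a δ) (b δ)
                          {γ | Metric.infDist x₀ γ.curve.range ≤ r} *
                        ENNReal.ofReal (ε₀ ^ 2))) :=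
  ⟨fun h =>
    ⟨fun D a b hab =>
        EventualTight.Negative.exists_isTightMeasureSet_image_of_convergesInLawToSLE hab (h D a b hab),
      dock_of_sawScalingLimit h, latticeAreaLaw_of_sawScalingLimit h⟩,
    fun h => closes h.1 (SubseqIdentification_of_dock_of_latticeAreaLaw h.2.1 h.2.2 h.1)⟩

end Summit.CriticalPhenomena.SAWScalingLimit.Theorems.SubseqIdentification.BoundaryAreaLaw
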